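import Literature.NumberTheory.PAdicHodge.BdRPlusLog
import Literature.NumberTheory.GaloisRepresentations.LubinTatePoints
import Mathlib.RingTheory.AdicCompletion.Topology
import Mathlib.Topology.Algebra.Nonarchimedean.AdicTopology
import HarnessLib

/-!
# `B_dR⁺(F)` as a `ξ`-adic topological ring: evaluation of power series on `Fil¹ = ξ B_dR⁺` and `Γ_F`-equivariance

Topic `Literature/NumberTheory/PAdicHodge`. Companion of `AinfTopology` on the `B_dR⁺` side. Fontaine's `B_dR⁺(F)` is a
complete discrete valuation ring with maximal ideal `Fil¹ = ker θ = (ξ_dR)` (tree `BdRPlusDVR`, `BdRPlusTheta`,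
`isAdicComplete_span_xiBdR`). Every power series with coefficients in `ℚ` (indeed in any discretely topologised
ring mapping to `B_dR⁺`, e.g. `F`) can therefore be evaluated at elements of `Fil¹`, the series converging
`ξ`-adically — this is how `t = log[ε]` is built in the tree (`BdRPlusLog.tBdR`, via truncated logarithms), and how
the `p`-adic period of the invariant differential of a formal group `∫_u ω = log_𝔉([u])` is defined (Fontaine 1982;
Colmez 1992 §2; `[u] ∈ ker θ` by the tree's `AinfTop.theta_torsionLift`). This file packages the mechanism once and
for all through Mathlib's topological evaluation `MvPowerSeries.aeval` (tree `LubinTate.evalPt`):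

* §1 `BdRPlusTop F p` — the type synonym of `B_dR⁺(F)` with the `ξ_dR`-adic topology (Mathlib `WithIdeal`): complete,
  Hausdorff, linearly topologised; `BdRPlusTop.filOne` — `Fil¹ = (ξ_dR)` as a closed `LubinTate.NilIdeal`.
* §2 `BdRPlusTop.gal σ` — `Γ_F` acts continuously (`σ(ξ_dR) ∈ (ξ_dR)`, tree `galBdRPlus_mem_span`) and preserves
  `Fil¹`; `BdRPlusTop.ofAinf` — `𝔸_inf → B_dR⁺` maps `ker θ = ξ𝔸_inf` into `Fil¹`.
* §3 `RatCoeff` — `ℚ` as a DISCRETE coefficient ring with `Algebra RatCoeff (BdRPlusTop F p)` (tree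
  `instAlgebraRatBDeRhamPlus`); evaluation of `f ∈ ℚ⟦X⟧` (constant-term-free) at `x ∈ Fil¹` is `LubinTate.evalPt₁`,
  with values in `Fil¹`; **`gal_evalPt₁`: `σ(f(x)) = f(σ x)`** (`MvPowerSeries.comp_aeval`, `σ` fixes `ℚ`).

Definitions (reviewed): `BdRPlusTop`, `BdRPlusTop.of`, `BdRPlusTop.filOne`, `BdRPlusTop.gal`, `BdRPlusTop.ofAinf`,
`RatCoeff`, `RatCoeff.of`, `BdRPlusTop.galAlgHom`. No named facts, no `sorry`. Infrastructure for the ω-period of formal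
groups (supersingular sector of hDR); nothing about elliptic curves is proved here.

## References
* J.-M. Fontaine, *Le corps des périodes p-adiques*, Astérisque 223 (1994), Exp. II §1.5 (`B_dR⁺`, its topology,
  `t = log[ε]`). [FontaineAsterisque223III]
* J.-M. Fontaine, Y. Ouyang, *Theory of p-adic Galois representations*, §5.1–5.2. [FontaineOuyang2022]
* J.-P. Serre, *Local class field theory* (Cassels–Fröhlich Ch. VI) §3.2 (points of formal groups in complete rings). [CasselsFrohlichANT1967]
-/

noncomputable section

open Ideal MvPowerSeries Field

namespace Literature.NumberTheory.PAdicHodge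

open Literature.NumberTheory.GaloisRepresentations
open Literature.NumberTheory.GaloisRepresentations.IsNonarchimedeanLocalField
open Literature.NumberTheory.GaloisRepresentations.LubinTate

variable (F : Type) [Field F] [ValuativeRel F] [TopologicalSpace F] [IsNonarchimedeanLocalField F] [CharZero F]
  (p : ℕ) [Fact p.Prime] [Fact (¬ IsUnit (p : integerC F))]
  [IsAdicComplete (Ideal.span {(p : integerC F)}) (integerC F)]

/-! ## §1 `B_dR⁺(F)` with its `ξ`-adic topology -/

/-- **`B_dR⁺(F)` as a topological ring**: the type synonym of `B_dR⁺(F)` carrying the `ξ_dR`-adic (= `ker θ`-adic)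
topology. [cite: FontaineAsterisque223III, Exp. II §1.5.3] -/
def BdRPlusTop : Type := BDeRhamPlus (integerC F) p

namespace BdRPlusTop

/-- Ring structure (that of `B_dR⁺`). [folklore] -/
instance : CommRing (BdRPlusTop F p) := inferInstanceAs (CommRing (BDeRhamPlus (integerC F) p))

/-- The preferred ideal `(ξ_dR) = Fil¹ = ker θ`, giving the adic topology through Mathlib's `WithIdeal`.
[cite: FontaineAsterisque223III, Exp. II §1.5.3] -/
instance : WithIdeal (BdRPlusTop F p) := ⟨(Ideal.span {(xiBdR : BDeRhamPlus (integerC F) p)} : Ideal (BDeRhamPlus (integerC F) p))⟩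

/-- The identification `B_dR⁺(F) = BdRPlusTop F p` (identity). [folklore] -/
def of : BDeRhamPlus (integerC F) p ≃+* BdRPlusTop F p := RingEquiv.refl _

omit [CharZero F] in
/-- The defining ideal is `(ξ_dR)`. [cite: FontaineAsterisque223III, Exp. II §1.5.3] -/
theorem ideal_eq : (WithIdeal.i : Ideal (BdRPlusTop F p)) = Ideal.span {of F p xiBdR} := rfl

omit [CharZero F] in
/-- The topology is the `ξ_dR`-adic one. [cite: FontaineAsterisque223III, Exp. II §1.5.3] -/
theorem isAdic : IsAdic (WithIdeal.i : Ideal (BdRPlusTop F p)) := rfl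

/-- **`B_dR⁺` is complete** for the `ξ`-adic topology. [cite: FontaineAsterisque223III, Exp. II §1.5.5] -/
instance : CompleteSpace (BdRPlusTop F p) :=
  ((isAdic F p).isAdicComplete_iff.1 (isAdicComplete_span_xiBdR (F := F) (p := p))).1

/-- **`B_dR⁺` is Hausdorff** for the `ξ`-adic topology. [cite: FontaineAsterisque223III, Exp. II §1.5.5] -/
instance : T2Space (BdRPlusTop F p) :=
  ((isAdic F p).isAdicComplete_iff.1 (isAdicComplete_span_xiBdR (F := F) (p := p))).2

variable {F p}

omit [CharZero F] in
/-- Powers of `(ξ_dR)` are neighbourhoods of `0`. [cite: FontaineAsterisque223III, Exp. II §1.5.3] -/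
theorem pow_mem_nhds_zero (n : ℕ) : ((WithIdeal.i ^ n : Ideal (BdRPlusTop F p)) : Set (BdRPlusTop F p)) ∈ nhds 0 :=
  (Ideal.hasBasis_nhds_zero_adic (WithIdeal.i : Ideal (BdRPlusTop F p))).mem_of_mem trivial

omit [CharZero F] in
/-- An ideal containing a power of `(ξ_dR)` is open. [cite: FontaineAsterisque223III, Exp. II §1.5.3] -/
theorem isOpen_of_pow_le {J : Ideal (BdRPlusTop F p)} {n : ℕ} (h : WithIdeal.i ^ n ≤ J) :
    IsOpen (J : Set (BdRPlusTop F p)) :=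
  J.toAddSubgroup.isOpen_of_mem_nhds (Filter.mem_of_superset (pow_mem_nhds_zero n) h)

omit [CharZero F] in
/-- An ideal containing a power of `(ξ_dR)` is closed. [cite: FontaineAsterisque223III, Exp. II §1.5.3] -/
theorem isClosed_of_pow_le {J : Ideal (BdRPlusTop F p)} {n : ℕ} (h : WithIdeal.i ^ n ≤ J) :
    IsClosed (J : Set (BdRPlusTop F p)) :=
  (⟨J.toAddSubgroup, isOpen_of_pow_le h⟩ : OpenAddSubgroup (BdRPlusTop F p)).isClosed

variable (F p) in
/-- **`Fil¹ B_dR⁺ = (ξ_dR)` as a closed nil ideal** (the domain of evaluation of power series: its elements are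
topologically nilpotent for the `ξ`-adic topology). [cite: FontaineAsterisque223III, Exp. II §1.5.4] -/
def filOne : NilIdeal (BdRPlusTop F p) where
  toIdeal := WithIdeal.i
  isClosed := isClosed_of_pow_le (n := 1) (by rw [pow_one])
  isTopologicallyNilpotent _ ha := WithIdeal.isTopologicallyNilpotent_of_mem ha

omit [CharZero F] in
/-- Membership in `Fil¹`: `x ∈ (ξ_dR)`. [cite: FontaineAsterisque223III, Exp. II §1.5.4] -/
theorem mem_filOne_iff {x : BdRPlusTop F p} :
    x ∈ (filOne F p).toIdeal ↔ (of F p).symm x ∈ Ideal.span {(xiBdR : BDeRhamPlus (integerC F) p)} := Iff.rfl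

/-! ## §2 `Γ_F` and `𝔸_inf → B_dR⁺` -/

variable (F p) in
/-- **The action of `σ ∈ Γ_F` on `B_dR⁺`** (tree `galBdRPlus`) on the topological ring `BdRPlusTop F p`.
[cite: FontaineAsterisque223III, Exp. II §1.5] -/
def gal (σ : absoluteGaloisGroup F) : BdRPlusTop F p →+* BdRPlusTop F p :=
  (of F p).toRingHom.comp ((galBdRPlus σ).comp (of F p).symm.toRingHom)

/-- Unfolding `gal`. [cite: FontaineAsterisque223III, Exp. II §1.5] -/
theorem gal_of (σ : absoluteGaloisGroup F) (b : BDeRhamPlus (integerC F) p) :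
    gal F p σ (of F p b) = of F p (galBdRPlus σ b) := rfl

/-- `σ(ξ_dR) ∈ (ξ_dR)`: `σ` maps the defining ideal into itself. [cite: FontaineAsterisque223III, Exp. II §1.5] -/
theorem ideal_map_gal_le (σ : absoluteGaloisGroup F) :
    (WithIdeal.i : Ideal (BdRPlusTop F p)).map (gal F p σ) ≤ WithIdeal.i := by
  rw [ideal_eq, Ideal.map_span, Ideal.span_le, Set.image_singleton, Set.singleton_subset_iff, SetLike.mem_coe, gal_of]
  exact galBdRPlus_mem_span σ (Ideal.mem_span_singleton_self _)

/-- **`σ` is continuous** on `BdRPlusTop`. [cite: FontaineAsterisque223III, Exp. II §1.5.3] -/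
theorem continuous_gal (σ : absoluteGaloisGroup F) : Continuous (gal F p σ) :=
  (WithIdeal.uniformContinuous_of_map_le (ideal_map_gal_le σ)).continuous

/-- `σ` preserves `Fil¹`. [cite: FontaineAsterisque223III, Exp. II §1.5] -/
theorem gal_mem_filOne (σ : absoluteGaloisGroup F) {x : BdRPlusTop F p} (hx : x ∈ (filOne F p).toIdeal) :
    gal F p σ x ∈ (filOne F p).toIdeal :=
  ideal_map_gal_le σ (Ideal.mem_map_of_mem _ hx)

variable (F p) in
/-- **`𝔸_inf(F) → B_dR⁺(F)`** (tree `ainfToBdR`) with values in the topological ring `BdRPlusTop F p`.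
[cite: FontaineAsterisque223III, Exp. II §1.5.2] -/
def ofAinf : Ainf (p := p) F →+* BdRPlusTop F p := (of F p).toRingHom.comp ainfToBdR

omit [CharZero F] in
/-- `ofAinf ξ = ξ_dR`. [cite: FontaineAsterisque223III, Exp. II §1.5.2] -/
theorem ofAinf_xi : ofAinf F p xi = of F p xiBdR := rfl

omit [CharZero F] in
/-- **`ker θ = ξ𝔸_inf` maps into `Fil¹`**: `ofAinf (ξ c) ∈ (ξ_dR)`. [cite: FontaineAsterisque223III, Exp. II §1.5.2] -/
theorem ofAinf_mem_filOne {a : Ainf (p := p) F} (ha : a ∈ Ideal.span {(xi : Ainf (p := p) F)}) :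
    ofAinf F p a ∈ (filOne F p).toIdeal := by
  obtain ⟨c, rfl⟩ := Ideal.mem_span_singleton'.1 ha
  rw [map_mul, ofAinf_xi]
  exact Ideal.mul_mem_left _ _ (Ideal.mem_span_singleton_self _)

/-- `σ ∘ ofAinf = ofAinf ∘ σ` (tree `galBdRPlus_ainfToBdR`). [cite: FontaineAsterisque223III, Exp. II §1.5] -/
theorem gal_ofAinf (σ : absoluteGaloisGroup F) (a : Ainf (p := p) F) :
    gal F p σ (ofAinf F p a) = ofAinf F p (galAinf σ a) :=
  congrArg (of F p) (galBdRPlus_ainfToBdR σ a)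

/-! ## §3 `ℚ` as a discrete coefficient ring and `Γ_F`-equivariance of evaluation -/

/-- **`ℚ` as a DISCRETE coefficient ring** for power-series evaluation in `B_dR⁺` (the series `log_𝔉`, `exp_𝔉`
have rational coefficients). [folklore] -/
def _root_.Literature.NumberTheory.PAdicHodge.RatCoeff : Type := ℚ

/-- Ring structure on the discrete copy of `ℚ`. [folklore] -/
instance : CommRing RatCoeff := inferInstanceAs (CommRing ℚ)
/-- Discrete uniformity on the coefficient ring. [folklore] -/
instance : UniformSpace RatCoeff := ⊥
/-- The coefficient ring is discretely uniformised. [folklore] -/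
instance : DiscreteUniformity RatCoeff := ⟨rfl⟩

/-- The identification `ℚ = RatCoeff`. [folklore] -/
def _root_.Literature.NumberTheory.PAdicHodge.RatCoeff.of : ℚ ≃+* RatCoeff := RingEquiv.refl _

/-- `B_dR⁺` as an algebra over the discrete copy of `ℚ` (tree `instAlgebraRatBDeRhamPlus`). [folklore] -/
instance instAlgebraRatCoeff : Algebra RatCoeff (BdRPlusTop F p) :=
  (((of F p).toRingHom.comp (algebraMap ℚ (BDeRhamPlus (integerC F) p))).comp RatCoeff.of.symm.toRingHom).toAlgebra

omit [CharZero F] in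
/-- Unfolding the algebra map. [cite: FontaineAsterisque223III, Exp. II §1.5] -/
theorem algebraMap_ratCoeff (q : RatCoeff) :
    algebraMap RatCoeff (BdRPlusTop F p) q = of F p (algebraMap ℚ (BDeRhamPlus (integerC F) p) (RatCoeff.of.symm q)) := rfl

/-- The discrete coefficient ring acts continuously. [folklore] -/
instance : ContinuousSMul RatCoeff (BdRPlusTop F p) := by
  refine ⟨continuous_prod_of_discrete_left.mpr fun a => ?_⟩
  change Continuous fun s : BdRPlusTop F p => algebraMap RatCoeff (BdRPlusTop F p) a * s
  exact continuous_const_mul _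

/-- `σ ∈ Γ_F` as a `RatCoeff`-algebra endomorphism (`σ` fixes `ℚ`, tree `galBdRPlus_algebraMap_rat`). [folklore] -/
def galAlgHom (σ : absoluteGaloisGroup F) : BdRPlusTop F p →ₐ[RatCoeff] BdRPlusTop F p :=
  { gal F p σ with
    commutes' := fun q => by
      show gal F p σ (algebraMap RatCoeff (BdRPlusTop F p) q) = algebraMap RatCoeff (BdRPlusTop F p) q
      rw [algebraMap_ratCoeff, gal_of, galBdRPlus_algebraMap_rat] }

/-- Unfolding `galAlgHom`. [cite: FontaineAsterisque223III, Exp. II §1.5] -/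
@[simp] theorem galAlgHom_apply (σ : absoluteGaloisGroup F) (x : BdRPlusTop F p) :
    galAlgHom σ x = gal F p σ x := rfl

/-- **`Γ_F` commutes with evaluation**: `σ(f(x)) = f(σ x)` for `f ∈ ℚ⟦X⟧` and a topologically nilpotent family `x`
in `B_dR⁺` (Mathlib `MvPowerSeries.comp_aeval`; `σ` continuous and `ℚ`-linear). [cite: FontaineAsterisque223III, Exp. II §1.5.4] -/
theorem gal_aeval (σ : absoluteGaloisGroup F) {ι : Type*} {x : ι → BdRPlusTop F p} (hx : HasEval x)
    (f : MvPowerSeries ι RatCoeff) :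
    gal F p σ (aeval hx f) =
      aeval (hx.map (φ := ((galAlgHom (F := F) (p := p) σ : BdRPlusTop F p →ₐ[RatCoeff] BdRPlusTop F p) :
        BdRPlusTop F p →+* BdRPlusTop F p)) (continuous_gal (F := F) (p := p) σ)) f := by
  have h := MvPowerSeries.comp_aeval hx (ε := galAlgHom (F := F) (p := p) σ) (continuous_gal (F := F) (p := p) σ)
  exact AlgHom.congr_fun h f

/-- `aeval` at equal point families. [cite: CasselsFrohlichANT1967, Ch. VI §3.2] -/
theorem aeval_congr_point' {σ' : Type*} {a b : σ' → BdRPlusTop F p} (ha : HasEval a) (hb : HasEval b)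
    (h : a = b) (f : MvPowerSeries σ' RatCoeff) : aeval ha f = aeval hb f := by
  subst h; rfl

/-- **`σ(f(x)) = f(σ x)` on points of `Fil¹`.** [cite: FontaineAsterisque223III, Exp. II §1.5.4] -/
theorem gal_evalPt (σ : absoluteGaloisGroup F) {ι : Type*} [Finite ι] (f : MvPowerSeries ι RatCoeff)
    (hf : f.constantCoeff = 0) (x y : ι → (filOne F p).toIdeal) (hxy : ∀ i, gal F p σ (x i : BdRPlusTop F p) = y i) :
    gal F p σ (evalPt (filOne F p) f hf x : BdRPlusTop F p) = (evalPt (filOne F p) f hf y : BdRPlusTop F p) := by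
  rw [coe_evalPt, coe_evalPt, gal_aeval σ ((filOne F p).hasEval x) f]
  exact aeval_congr_point' _ _ (funext fun i => hxy i) f

/-- **`σ(f(x)) = f(σ x)` for one-variable evaluation on `Fil¹`** — e.g. `σ(log_𝔉(x)) = log_𝔉(σ x)`, the
equivariance of the ω-period. [cite: FontaineAsterisque223III, Exp. II §1.5.4] -/
theorem gal_evalPt₁ (σ : absoluteGaloisGroup F) (f : PowerSeries RatCoeff) (hf : PowerSeries.constantCoeff f = 0)
    (x : (filOne F p).toIdeal) :
    gal F p σ (evalPt₁ (filOne F p) f hf x : BdRPlusTop F p) =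
      (evalPt₁ (filOne F p) f hf ⟨gal F p σ x, gal_mem_filOne σ x.2⟩ : BdRPlusTop F p) :=
  gal_evalPt σ (ι := Unit) f hf (fun _ => x) (fun _ => ⟨gal F p σ x, gal_mem_filOne σ x.2⟩) fun _ => rfl

end BdRPlusTop

end Literature.NumberTheory.PAdicHodge

end
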